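import Summits.ValiantsHypothesis.ValiantsHypothesis.Theorems.GrenetZeonDualUnipotentThreeHalvesLongMassNilSpaceEngelSubmodule
import Summits.ValiantsHypothesis.ValiantsHypothesis.Theorems.GrenetZeonDualUnipotentThreeHalvesLongMassNilSpaceRankCeiling
import Literature.LinearAlgebra.Matrix.GerstenhaberNilpotentSubspace

/-!
# `GrenetZeon.DualUnipotentThreeHalves` (stmt-ValiantsHypothesis-24318), line `slow_core`, stub (c) `SlowCore.LongMassSlowLawInv`:
# THE VIOLATOR PORTRAIT BY NAME — what an EXPENSIVE nil space must look like (submodule currency)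

In the coordinate-free currency of ✓ `longMassSlowLawInv_iff_submodule`, call `V ≤ M_b(ℂ)` EXPENSIVE at budget `P` (for the window `n`) if NO pair
`(W ≤ V, k)` with the window property has `n·k + (dim V − dim W) ≤ P`; (c) says that no nilpotent `V` with `dim V ≤ n²` is expensive at budget
`c·⌊√n⌋·b` (`n ≥ n₀`).  Crit-7's V34 §2 drew the portrait of a violator FAMILY in words; this file states each line as a kernel theorem about ONE
expensive space, by name, so that census / kit seats (R3 of the 26th hand's list) can cite the checklist:

* `finrank_gt_of_expensive` — MASS: `dim V > P` (freeze ceiling ✓ `price_freeze_submodule`);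
* `choose_two_gt_of_expensive` — SIZE: for a nil `V`, `P < C(b,2)` (Gerstenhaber, ✓ `Literature.….finrank_le_choose_two`), so at budget `c⌊√n⌋b`:
  `b > 2c⌊√n⌋ + 1`;
* `exists_pow_ne_zero_of_expensive` — LENGTH: for every `H ≥ 1` with `n(H − 1) ≤ P` some member has `A^H ≠ 0` (absorb ceiling
  ✓ `price_absorb_submodule`), i.e. index `> P/n + 1`;
* RANK (by name, ✓ `NilSpaceRankCeiling.exists_rank_mul_gt_of_expensive`): some member has `rank·b > P` (Flanders–Meshulam);
* `exists_word_ne_zero_of_expensive` — WILDNESS: if `dim V ≤ n²` and `3·⌊√n⌋·b ≤ P`, some `V`-WORD OF LENGTH `b` is non-zero (✓ `price_words_eq_zero_submodule`),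
  equivalently `not_triangularisable_of_expensive` (no unit conjugates `V` into the strictly upper triangular matrices, ✓ `conj_strictUpper_iff_words_eq_zero`)
  and, for nil `V`, `not_lieClosed_of_expensive` (`V` is NOT closed under the commutator — Engel, ✓ `price_lieClosed_submodule`);
* ★★ `violator_portrait` — the conjunction at the (c)-budget `P = c·(⌊√n⌋·b)`, `c ≥ 3`.

HONEST FRAMING.  A checklist assembled from landed ceilings/rows (`--supports stmt-ValiantsHypothesis-24318`); NOT progress on the research stub (c)
`SlowCore.LongMassSlowLawInv` (0 known expensive families at the (c)-budget); closes no stub; S3, 24318, 8062 and `VP ≠ VNP` are NOT proved.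
Def-free, no named-fact hypotheses, no sorry.
[cite: Meshulam1985, Thm. 2 (p. 226)] [cite: deSeguinsPazzis2013Gerstenhaber, Theorem 1] [cite: HornJohnson2013, Thm. 2.4.8.7 (p0162)]
-/

set_option linter.dupNamespace false
set_option autoImplicit false

noncomputable section

namespace Summit.ValiantsHypothesis.ValiantsHypothesis.Theorems.GrenetZeon.NilSpaceViolatorPortrait

open MvPolynomial Matrix
open scoped BigOperators
open Summit.ValiantsHypothesis.ValiantsHypothesis.Theorems.GrenetZeon.LongMassHomogenise (price_freeze_submodule price_absorb_submodule)
open Summit.ValiantsHypothesis.ValiantsHypothesis.Theorems.GrenetZeon.NilSpaceRankCeiling (exists_rank_gt_sqrt_of_expensive)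
open Summit.ValiantsHypothesis.ValiantsHypothesis.Theorems.GrenetZeon.NilSpaceEngel
  (price_words_eq_zero_submodule price_lieClosed_submodule words_eq_zero_of_conj_strictUpper)

variable {b : ℕ}

/-! ## §1 The lines of the portrait -/

/-- **MASS.**  An expensive space has `dim V > P`. -/
theorem finrank_gt_of_expensive (V : Submodule ℂ (Matrix (Fin b) (Fin b) ℂ)) (n P : ℕ)
    (hexp : ∀ (W : Submodule ℂ (Matrix (Fin b) (Fin b) ℂ)) (k : ℕ), W ≤ V →
      (∀ A ∈ V, ∀ w ∈ W, ∀ p : ℕ, p ≤ n - 1 → ∀ i j : Fin b,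
        ((((A.map (C : ℂ → MvPolynomial (Fin 1) ℂ) + (X 0 : MvPolynomial (Fin 1) ℂ) • w.map C) ^ p :
          Matrix (Fin b) (Fin b) (MvPolynomial (Fin 1) ℂ)) i j).totalDegree ≤ k)) →
      P < n * k + (Module.finrank ℂ V - Module.finrank ℂ W)) :
    P < Module.finrank ℂ V := by
  obtain ⟨W, k, hW, hwin, hprice⟩ := price_freeze_submodule V n
  exact lt_of_lt_of_le (hexp W k hW hwin) hprice

/-- **SIZE (Gerstenhaber).**  An expensive NIL space lives in size `b` with `P < C(b,2)`. [cite: deSeguinsPazzis2013Gerstenhaber, Theorem 1] -/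
theorem choose_two_gt_of_expensive (V : Submodule ℂ (Matrix (Fin b) (Fin b) ℂ)) (hnil : ∀ A ∈ V, IsNilpotent A) (n P : ℕ)
    (hexp : ∀ (W : Submodule ℂ (Matrix (Fin b) (Fin b) ℂ)) (k : ℕ), W ≤ V →
      (∀ A ∈ V, ∀ w ∈ W, ∀ p : ℕ, p ≤ n - 1 → ∀ i j : Fin b,
        ((((A.map (C : ℂ → MvPolynomial (Fin 1) ℂ) + (X 0 : MvPolynomial (Fin 1) ℂ) • w.map C) ^ p :
          Matrix (Fin b) (Fin b) (MvPolynomial (Fin 1) ℂ)) i j).totalDegree ≤ k)) →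
      P < n * k + (Module.finrank ℂ V - Module.finrank ℂ W)) :
    P < b.choose 2 :=
  lt_of_lt_of_le (finrank_gt_of_expensive V n P hexp)
    (Literature.LinearAlgebra.Matrix.GerstenhaberNilpotentSubspace.finrank_le_choose_two b V hnil)

/-- **LENGTH.**  In an expensive space, for every `H ≥ 1` with `n(H − 1) ≤ P` some member has `A^H ≠ 0` (the uniform index exceeds `P/n + 1`). -/
theorem exists_pow_ne_zero_of_expensive (V : Submodule ℂ (Matrix (Fin b) (Fin b) ℂ)) (n P : ℕ)
    (hexp : ∀ (W : Submodule ℂ (Matrix (Fin b) (Fin b) ℂ)) (k : ℕ), W ≤ V →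
      (∀ A ∈ V, ∀ w ∈ W, ∀ p : ℕ, p ≤ n - 1 → ∀ i j : Fin b,
        ((((A.map (C : ℂ → MvPolynomial (Fin 1) ℂ) + (X 0 : MvPolynomial (Fin 1) ℂ) • w.map C) ^ p :
          Matrix (Fin b) (Fin b) (MvPolynomial (Fin 1) ℂ)) i j).totalDegree ≤ k)) →
      P < n * k + (Module.finrank ℂ V - Module.finrank ℂ W))
    {H : ℕ} (hH : 1 ≤ H) (hbudget : n * (H - 1) ≤ P) : ∃ A ∈ V, A ^ H ≠ 0 := by
  by_contra hcon
  push Not at hcon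
  obtain ⟨W, k, hW, hwin, hprice⟩ := price_absorb_submodule V hH hcon n
  have := hexp W k hW hwin
  omega

-- RANK (Flanders–Meshulam): ✓ `NilSpaceRankCeiling.exists_rank_mul_gt_of_expensive` / `exists_rank_gt_sqrt_of_expensive` (landed, by name).

/-- **WILDNESS, word form.**  An expensive space (`dim V ≤ n²`, budget `≥ 3·⌊√n⌋·b`) has a NON-VANISHING WORD OF LENGTH `b`. [folklore] -/
theorem exists_word_ne_zero_of_expensive (V : Submodule ℂ (Matrix (Fin b) (Fin b) ℂ)) (n P : ℕ) (hV : Module.finrank ℂ V ≤ n * n)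
    (hP : 3 * (Nat.sqrt n * b) ≤ P)
    (hexp : ∀ (W : Submodule ℂ (Matrix (Fin b) (Fin b) ℂ)) (k : ℕ), W ≤ V →
      (∀ A ∈ V, ∀ w ∈ W, ∀ p : ℕ, p ≤ n - 1 → ∀ i j : Fin b,
        ((((A.map (C : ℂ → MvPolynomial (Fin 1) ℂ) + (X 0 : MvPolynomial (Fin 1) ℂ) • w.map C) ^ p :
          Matrix (Fin b) (Fin b) (MvPolynomial (Fin 1) ℂ)) i j).totalDegree ≤ k)) →
      P < n * k + (Module.finrank ℂ V - Module.finrank ℂ W)) :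
    ∃ w : Fin b → Matrix (Fin b) (Fin b) ℂ, (∀ t, w t ∈ V) ∧ (List.ofFn w).prod ≠ 0 := by
  by_contra hcon
  push Not at hcon
  obtain ⟨W, k, hW, hwin, hprice⟩ := price_words_eq_zero_submodule V hV (s := b) fun w hw => hcon w hw
  have := hexp W k hW hwin
  omega

/-- **WILDNESS, basis form.**  An expensive space (`dim V ≤ n²`, budget `≥ 3·⌊√n⌋·b`) is NOT simultaneously strictly triangularisable. [folklore] -/
theorem not_triangularisable_of_expensive (V : Submodule ℂ (Matrix (Fin b) (Fin b) ℂ)) (n P : ℕ) (hV : Module.finrank ℂ V ≤ n * n)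
    (hP : 3 * (Nat.sqrt n * b) ≤ P)
    (hexp : ∀ (W : Submodule ℂ (Matrix (Fin b) (Fin b) ℂ)) (k : ℕ), W ≤ V →
      (∀ A ∈ V, ∀ w ∈ W, ∀ p : ℕ, p ≤ n - 1 → ∀ i j : Fin b,
        ((((A.map (C : ℂ → MvPolynomial (Fin 1) ℂ) + (X 0 : MvPolynomial (Fin 1) ℂ) • w.map C) ^ p :
          Matrix (Fin b) (Fin b) (MvPolynomial (Fin 1) ℂ)) i j).totalDegree ≤ k)) →
      P < n * k + (Module.finrank ℂ V - Module.finrank ℂ W)) :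
    ¬ ∃ Q : (Matrix (Fin b) (Fin b) ℂ)ˣ, ∀ A ∈ V, ∀ i j : Fin b, j ≤ i →
      ((Q : Matrix (Fin b) (Fin b) ℂ) * A * (↑Q⁻¹ : Matrix (Fin b) (Fin b) ℂ)) i j = 0 := by
  rintro ⟨Q, hQ⟩
  obtain ⟨w, hw, hne⟩ := exists_word_ne_zero_of_expensive V n P hV hP hexp
  exact hne (words_eq_zero_of_conj_strictUpper V Q hQ w hw)

/-- **WILDNESS, Lie form (Engel).**  An expensive NIL space (`dim V ≤ n²`, budget `≥ 3·⌊√n⌋·b`) is NOT closed under the commutator.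
[cite: HornJohnson2013, Thm. 2.4.8.7 (p0162)] -/
theorem not_lieClosed_of_expensive (V : Submodule ℂ (Matrix (Fin b) (Fin b) ℂ)) (hnil : ∀ A ∈ V, IsNilpotent A) (n P : ℕ)
    (hV : Module.finrank ℂ V ≤ n * n) (hP : 3 * (Nat.sqrt n * b) ≤ P)
    (hexp : ∀ (W : Submodule ℂ (Matrix (Fin b) (Fin b) ℂ)) (k : ℕ), W ≤ V →
      (∀ A ∈ V, ∀ w ∈ W, ∀ p : ℕ, p ≤ n - 1 → ∀ i j : Fin b,
        ((((A.map (C : ℂ → MvPolynomial (Fin 1) ℂ) + (X 0 : MvPolynomial (Fin 1) ℂ) • w.map C) ^ p :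
          Matrix (Fin b) (Fin b) (MvPolynomial (Fin 1) ℂ)) i j).totalDegree ≤ k)) →
      P < n * k + (Module.finrank ℂ V - Module.finrank ℂ W)) :
    ∃ A ∈ V, ∃ B ∈ V, A * B - B * A ∉ V := by
  by_contra hcon
  push Not at hcon
  obtain ⟨W, k, hW, hwin, hprice⟩ := price_lieClosed_submodule V hV hnil hcon
  have := hexp W k hW hwin
  omega

/-! ## §2 The portrait at the (c)-budget -/

/-- ★★ **THE VIOLATOR PORTRAIT** at the (c)-budget `c·(⌊√n⌋·b)`, `c ≥ 3`: a nilpotent `V ≤ M_b(ℂ)` with `dim V ≤ n²` and NO certificate of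
price `≤ c·⌊√n⌋·b` has — MASS `dim V > c⌊√n⌋b`, SIZE `c⌊√n⌋b < C(b,2)`, LENGTH a member with `A^H ≠ 0` whenever `1 ≤ H` and `n(H−1) ≤ c⌊√n⌋b`,
RANK a member of rank `> c⌊√n⌋`, WILDNESS a non-vanishing word of length `b` and a commutator leaving `V`.  (0 known instances for `n` large.)
[cite: Meshulam1985, Thm. 2 (p. 226)] [cite: deSeguinsPazzis2013Gerstenhaber, Theorem 1] -/
theorem violator_portrait (V : Submodule ℂ (Matrix (Fin b) (Fin b) ℂ)) (hnil : ∀ A ∈ V, IsNilpotent A) (n c : ℕ)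
    (hV : Module.finrank ℂ V ≤ n * n) (hc : 3 ≤ c)
    (hexp : ∀ (W : Submodule ℂ (Matrix (Fin b) (Fin b) ℂ)) (k : ℕ), W ≤ V →
      (∀ A ∈ V, ∀ w ∈ W, ∀ p : ℕ, p ≤ n - 1 → ∀ i j : Fin b,
        ((((A.map (C : ℂ → MvPolynomial (Fin 1) ℂ) + (X 0 : MvPolynomial (Fin 1) ℂ) • w.map C) ^ p :
          Matrix (Fin b) (Fin b) (MvPolynomial (Fin 1) ℂ)) i j).totalDegree ≤ k)) →
      c * (Nat.sqrt n * b) < n * k + (Module.finrank ℂ V - Module.finrank ℂ W)) :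
    c * (Nat.sqrt n * b) < Module.finrank ℂ V ∧
      c * (Nat.sqrt n * b) < b.choose 2 ∧
      (∀ H : ℕ, 1 ≤ H → n * (H - 1) ≤ c * (Nat.sqrt n * b) → ∃ A ∈ V, A ^ H ≠ 0) ∧
      (∃ A ∈ V, c * Nat.sqrt n < A.rank) ∧
      (∃ w : Fin b → Matrix (Fin b) (Fin b) ℂ, (∀ t, w t ∈ V) ∧ (List.ofFn w).prod ≠ 0) ∧
      (∃ A ∈ V, ∃ B ∈ V, A * B - B * A ∉ V) := by
  have hP : 3 * (Nat.sqrt n * b) ≤ c * (Nat.sqrt n * b) := Nat.mul_le_mul_right _ hc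
  exact ⟨finrank_gt_of_expensive V n _ hexp, choose_two_gt_of_expensive V hnil n _ hexp,
    fun H hH hbud => exists_pow_ne_zero_of_expensive V n _ hexp hH hbud,
    exists_rank_gt_sqrt_of_expensive V n c hexp,
    exists_word_ne_zero_of_expensive V n _ hV hP hexp, not_lieClosed_of_expensive V hnil n _ hV hP hexp⟩

end Summit.ValiantsHypothesis.ValiantsHypothesis.Theorems.GrenetZeon.NilSpaceViolatorPortrait

end
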